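import Literature.Analysis.FluidPDE.TaoAveragedCascadeSteps
import Literature.Analysis.FluidPDE.TaoAveragedSlotMeasurable
import Literature.Analysis.FluidPDE.TaoAveragedSlotSobolev
import HarnessLib

/-!
# Tao 2016, §3.5 (fifth step: extracting the symbol), and the reduction of (3.9) to the
rotation-averaging identity (3.13)

T. Tao, *Finite time blowup for an averaged three-dimensional Navier–Stokes equation*,
J. Amer. Math. Soc. **29** (2016), 601–674 = arXiv:1402.0290v3 (held as `paper:arxiv-1402.0290`;
all numbers are those of that text), §3.5, pp. 17–18.

The named fact `singleScale_isComplexAverageNoDil` (`TaoAveragedCascadeSteps.lean`; §3.5–§3.9: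
for normalised profiles the single-scale operator `C₀` of (3.8) is a dilation-free complex
average (3.9) of `B_{η,ρ,0}`) is the core of Theorem 3.2. §3.5 rewrites both sides of (3.9) on
the Fourier side and reduces it to the tensor identity (3.13), which §3.6–§3.9 then establish by
rotation averaging. This file proves the two rewritings and the reduction:

* `pairing_conjL2_schwartz` — **Plancherel for the factors of `C₀`** (the first display of
  §3.5, (3.12)): `⟨u, ψ̄⟩ = ∫ û(ξ) · \overline{ψ̂(ξ)} dξ` for `u ∈ L²(ℝ³; ℂ³)` and a Schwartz
  field `ψ` (Mathlib's unitary `L²` Fourier transform and `SchwartzMap.toLp_fourier_eq`);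
* `ComplexAveragingDatum.slotFreq`, `ComplexAveragingDatum.freqSideIntegrand` and
  `ComplexAveragingDatum.betaRhoZeroForm_slot` — **the Fourier side of the right-hand side of
  (3.9)** (the display after "Meanwhile, the right-hand side of (3.9) can be expanded as"):
  for a dilation-free datum,
  `⟨B_{η,ρ,0}(m₁(D) Rot_{R₁} u, m₂(D) Rot_{R₂} v), m₃(D) Rot_{R₃} w⟩ = ∫_{ξ₁+ξ₂+ξ₃=0} φ(|ξ₁-ξ₁⁰|/ε₀²) η(|ξ₁|,|ξ₂|,|ξ₃|) Λ_{ξ₁,ξ₂,ξ₃}(m₁(ξ₁) R₁ û(R₁⁻¹ξ₁), m₂(ξ₂) R₂ v̂(R₂⁻¹ξ₂), m₃(ξ₃) R₃ ŵ(R₃⁻¹ξ₃))`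
  (`\widehat{m(D) Rot_R u}(ξ) = m(ξ) R û(R⁻¹ξ)`, the tree's `fourierFn_slot_ae_eq`, pulled back
  along the quasi-measure-preserving coordinate maps of `{ξ₁+ξ₂+ξ₃=0} ≅ ℝ³ × ℝ³`);
* `rotationAverage_tensorIdentity` — **the claim of §3.5 in its integrated form**, a named fact
  (`Prop`-valued definition, not asserted): for `ε₀` below an absolute threshold and normalised
  profiles there is a dilation-free complex averaging datum `(Ω, μ, m_{j,ω}, R_{j,ω})` such that
  `∫_Ω ∫_{ξ₁+ξ₂+ξ₃=0} φ η Λ(m_{1,ω}(ξ₁) R_{1,ω} û(R_{1,ω}⁻¹ξ₁), …) dμ(ω) = ∏ⱼ ∫ X̂ⱼ(ξ) · \overline{ψ̂ⱼ(ξ)} dξ`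
  for all `u, v, w ∈ H¹⁰_df ⊗ ℂ` — Tao: "our task is now reduced to that of constructing a
  finite measure space `(Ω,μ)` and measurable functions `R_{i,·}`, `m_{i,·}(D)`, `F` obeying (3.5)
  … such that we have the identity (3.13) … Indeed, if one applies (3.13) with
  `(X₁,X₂,X₃) = (û(ξ₁), v̂(ξ₂), ŵ(ξ₃))`, contracts … against `\overline{ψ̂₁(ξ₁)} ⊗ \overline{ψ̂₂(ξ₂)} ⊗ \overline{ψ̂₃(ξ₃)}`
  and then integrates in `ξ₁, ξ₂, ξ₃` … we obtain the desired decomposition (3.9)"; the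
  delta function `δ(R_{1,ω}ξ₁ + R_{2,ω}ξ₂ + R_{3,ω}ξ₃)` of (3.13) is, rigorously, this integrated
  statement (Tao's footnote 5), and (3.13) itself is the content of §3.6–§3.9;
* `singleScale_isComplexAverageNoDil_of_tensorIdentity` — **(3.9) from (3.13)**, proved.

## References

* T. Tao, J. Amer. Math. Soc. 29 (2016), 601–674, arXiv:1402.0290v3, §3.4 (3.8)–(3.9), §3.5
  pp. 17–18 ((3.12)–(3.13)), §3.6–§3.9 pp. 18–20. Key `Tao2016AveragedNS`.
-/

noncomputable section

open MeasureTheory Set Filter FourierTransform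
open scoped ENNReal NNReal SchwartzMap ComplexConjugate InnerProductSpace

namespace Literature.Analysis.FluidPDE.Tao2016

/-- Local notation for physical / frequency space `ℝ³`. -/
local notation "ℝ³" => EuclideanSpace ℝ (Fin 3)
/-- Local notation for the complexified range `ℂ³`. -/
local notation "ℂ³" => EuclideanSpace ℂ (Fin 3)

/-! ### Plancherel for the factors `⟨u, ψ̄ⱼ⟩` of `C₀` -/

/-- The bilinear pairing against a conjugate field is the `L²` inner product:
`⟨u, w̄⟩ = ∫ u · w̄ = ⟪w, u⟫_{L²}` (a local copy of `pairing_conjL2_eq_inner` of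
`TaoAveragedRotDil.lean`, whose imports are not needed here). [folklore] -/
private theorem pairing_conjL2_eq_inner_aux (u w : L2C) : pairing u (conjL2 w) = ⟪w, u⟫_ℂ := by
  rw [MeasureTheory.L2.inner_def]
  unfold pairing
  refine integral_congr_ae ?_
  filter_upwards [coeFn_conjL2 w] with x hx
  rw [hx]
  simp [cdot, PiLp.inner_apply]

/-- **Plancherel for the factors of `C₀` (Tao 2016, §3.5, first display / (3.12))**:
`⟨u, ψ̄⟩ = ∫ û(ξ) · \overline{ψ̂(ξ)} dξ` for `u ∈ L²(ℝ³; ℂ³)` and a Schwartz field `ψ`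
("By (3.8) and Plancherel's theorem, we may expand `⟨C₀(u,v),w⟩` as
`∫∫∫ (û(ξ₁) · \overline{ψ̂₁(ξ₁)}) (v̂(ξ₂) · \overline{ψ̂₂(ξ₂)}) (ŵ(ξ₃) · \overline{ψ̂₃(ξ₃)}) dξ₁ dξ₂ dξ₃`").
Here `û = fourierFn u` is Mathlib's unitary `L²` Fourier transform and `ψ̂ = 𝓕 ψ` the Fourier
integral, in Tao's normalisation. [cite: Tao2016AveragedNS, §3.5 (3.12)] -/
theorem pairing_conjL2_schwartz (u : L2C) (ψ : 𝓢(ℝ³, ℂ³)) :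
    pairing u (conjL2 (ψ.toLp 2)) = ∫ ξ, cdot (fourierFn u ξ) (conj3 (𝓕 (⇑ψ) ξ)) := by
  rw [pairing_conjL2_eq_inner_aux, ← MeasureTheory.Lp.inner_fourier_eq, MeasureTheory.L2.inner_def,
    SchwartzMap.toLp_fourier_eq]
  refine integral_congr_ae ?_
  filter_upwards [(𝓕 ψ).coeFn_toLp 2 (volume : Measure ℝ³)] with ξ hξ
  rw [hξ, SchwartzMap.fourier_coe]
  unfold fourierFn
  simp [cdot, PiLp.inner_apply]

/-! ### The Fourier side of the right-hand side of (3.9) -/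

namespace ComplexAveragingDatum

variable (𝒟 : ComplexAveragingDatum)

/-- **The Fourier side of a dilation-free slot** acting on a frequency function `X`:
`ξ ↦ m_{i,ω}(ξ) · R_{i,ω} X(R_{i,ω}⁻¹ ξ)` (Tao p. 17: `m_{1,ω}(ξ₁) … R_{1,ω} û(R_{1,ω}⁻¹ξ₁)`;
`\widehat{m(D) Rot_R u} = m · R û(R⁻¹·)`). [cite: Tao2016AveragedNS, §3.5 p. 17] -/
def slotFreq (i : Fin 3) (θ : 𝒟.Ω) (X : ℝ³ → ℂ³) (ξ : ℝ³) : ℂ³ :=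
  𝒟.m i θ ξ • rotMat (𝒟.R i θ) (X ((𝒟.R i θ).symm ξ))

/-- **The `ω`-integrand of the right-hand side of (3.9) on the Fourier side** (Tao 2016, §3.5,
the display after "Meanwhile, the right-hand side of (3.9) can be expanded as"), for frequency
functions `X₁, X₂, X₃ : ℝ³ → ℂ³`:
`∫_{ξ₁+ξ₂+ξ₃=0} φ(|ξ₁-ξ₁⁰|/ε₀²) η(|ξ₁|,|ξ₂|,|ξ₃|) Λ_{ξ₁,ξ₂,ξ₃}(m_{1,ω}(ξ₁) R_{1,ω} X₁(R_{1,ω}⁻¹ξ₁), m_{2,ω}(ξ₂) R_{2,ω} X₂(R_{2,ω}⁻¹ξ₂), m_{3,ω}(ξ₃) R_{3,ω} X₃(R_{3,ω}⁻¹ξ₃))`,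
with `∫_{ξ₁+ξ₂+ξ₃=0} F := ∫∫ F(ξ₁, ξ₂, -ξ₁-ξ₂) dξ₁dξ₂` as in `eulerForm` / `betaRhoZeroForm`
(Bochner junk `0`). [cite: Tao2016AveragedNS, §3.5 p. 17] -/
def freqSideIntegrand (ε₀ : ℝ) (θ : 𝒟.Ω) (X₁ X₂ X₃ : ℝ³ → ℂ³) : ℂ :=
  ∫ p : ℝ³ × ℝ³,
    ((freqCutoff (‖p.1 - xi0 0‖ / ε₀ ^ 2) * eta ε₀ ‖p.1‖ ‖p.2‖ ‖-p.1 - p.2‖ : ℝ) : ℂ) *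
      Λ p.1 p.2 (𝒟.slotFreq 0 θ X₁ p.1) (𝒟.slotFreq 1 θ X₂ p.2) (𝒟.slotFreq 2 θ X₃ (-p.1 - p.2))

/-- For a dilation-free datum, the Fourier transform of a slot is `m(ξ) R û(R⁻¹ξ)` a.e. (the
symbol cut off at the null set `{0}`). [cite: Tao2016AveragedNS, §1.1 p. 6 and §3.5 p. 17] -/
theorem fourierFn_slot_ae_eq_of_lam (hlam : ∀ i θ, 𝒟.lam i θ = 1) (i : Fin 3) (θ : 𝒟.Ω)
    (u : L2C) :
    fourierFn (𝒟.slot i θ u) =ᵐ[volume] fun ξ =>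
      Set.indicator {0}ᶜ (𝒟.m i θ) ξ • rotMat (𝒟.R i θ) (fourierFn u ((𝒟.R i θ).symm ξ)) := by
  filter_upwards [𝒟.fourierFn_slot_ae_eq i θ u] with ξ hξ
  rw [hξ, hlam i θ, inv_one, Real.one_rpow, Complex.ofReal_one, one_smul, one_smul]

/-- **The Fourier side of the right-hand side of (3.9)** (Tao 2016, §3.5): for a dilation-free
complex averaging datum and every `ω`,
`⟨B_{η,ρ,0}(m_{1,ω}(D) Rot_{R_{1,ω}} u, m_{2,ω}(D) Rot_{R_{2,ω}} v), m_{3,ω}(D) Rot_{R_{3,ω}} w⟩`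
equals the frequency-side integrand at `(û, v̂, ŵ)` — "`∫_{ξ₁+ξ₂+ξ₃=0} m_{1,ω}(ξ₁) m_{2,ω}(ξ₂) m_{3,ω}(ξ₃) φ(ε₀⁻²(ξ₁ - ξ₁⁰)) η(|ξ₁|,|ξ₂|,|ξ₃|) Λ_{ξ₁,ξ₂,ξ₃}(R_{1,ω} û(R_{1,ω}⁻¹ξ₁), R_{2,ω} v̂(R_{2,ω}⁻¹ξ₂), R_{3,ω} ŵ(R_{3,ω}⁻¹ξ₃))`"
(here with the scalars `m_{j,ω}(ξⱼ)` kept inside the trilinear `Λ`). [cite: Tao2016AveragedNS, §3.5 p. 17] -/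
theorem betaRhoZeroForm_slot (hlam : ∀ i θ, 𝒟.lam i θ = 1) (ε₀ : ℝ) (θ : 𝒟.Ω) (u v w : L2C) :
    betaRhoZeroForm ε₀ (𝒟.slot 0 θ u) (𝒟.slot 1 θ v) (𝒟.slot 2 θ w) =
      𝒟.freqSideIntegrand ε₀ θ (fourierFn u) (fourierFn v) (fourierFn w) := by
  rw [betaRhoZeroForm_eq]
  unfold freqSideIntegrand
  refine integral_congr_ae ?_
  have h0 : ∀ᵐ ξ ∂(volume : Measure ℝ³), ξ ∈ ({0}ᶜ : Set ℝ³) :=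
    compl_mem_ae_iff.mpr (measure_singleton _)
  have q1 := Measure.quasiMeasurePreserving_fst (μ := (volume : Measure ℝ³))
    (ν := (volume : Measure ℝ³))
  have q2 := Measure.quasiMeasurePreserving_snd (μ := (volume : Measure ℝ³))
    (ν := (volume : Measure ℝ³))
  have q3 := quasiMeasurePreserving_neg_fst_sub_snd
  rw [Measure.volume_eq_prod]
  filter_upwards [q1.ae_eq (𝒟.fourierFn_slot_ae_eq_of_lam hlam 0 θ u),
    q2.ae_eq (𝒟.fourierFn_slot_ae_eq_of_lam hlam 1 θ v),
    q3.ae_eq (𝒟.fourierFn_slot_ae_eq_of_lam hlam 2 θ w), q1.ae h0, q2.ae h0, q3.ae h0]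
    with p e1 e2 e3 n1 n2 n3
  simp only [Function.comp_apply] at e1 e2 e3
  rw [e1, e2, e3, Set.indicator_of_mem n1, Set.indicator_of_mem n2, Set.indicator_of_mem n3]
  rfl

end ComplexAveragingDatum

/-! ### The claim of §3.5: the rotation-averaging identity, integrated form of (3.13) -/

/-- **Tao 2016, §3.5 (claim) with §3.6–§3.9 (its proof): the rotation-averaging tensor
identity (3.13), in integrated form.** For `ε₀ > 0` below an absolute threshold and normalised
profiles `ψⱼ` (`ψ̂ⱼ` supported in `B(ξⱼ⁰, ε₀³)`, (3.7)) there is a complex averaging datum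
`(Ω, μ, m_{j,ω}, R_{j,ω})` (Def. 3.4) without dilations (`λ_{j,ω} ≡ 1`) such that for all
`u, v, w ∈ H¹⁰_df ⊗ ℂ`, with `X₁ = û`, `X₂ = v̂`, `X₃ = ŵ`,
`∫_Ω ∫_{ξ₁+ξ₂+ξ₃=0} φ(|ξ₁-ξ₁⁰|/ε₀²) η(|ξ₁|,|ξ₂|,|ξ₃|) Λ_{ξ₁,ξ₂,ξ₃}(m_{1,ω}(ξ₁) R_{1,ω} X₁(R_{1,ω}⁻¹ξ₁), m_{2,ω}(ξ₂) R_{2,ω} X₂(R_{2,ω}⁻¹ξ₂), m_{3,ω}(ξ₃) R_{3,ω} X₃(R_{3,ω}⁻¹ξ₃)) dμ(ω)`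
`= ∏_{j=1}^{3} ∫_{ℝ³} Xⱼ(ξ) · \overline{ψ̂ⱼ(ξ)} dξ`.
Tao, p. 17: "Comparing this with the expansion (3.12) of the left-hand side of (3.9), we claim
that our task is now reduced to that of constructing a finite measure space `(Ω,μ)` and
measurable functions `R_{i,·} : Ω → SO(3)`, `m_{i,·}(D) : Ω → 𝓜₀ ⊗ ℂ`, and
`F : Ω → ℂ³ ⊗ ℂ³ ⊗ ℂ³` obeying (3.5) with `F` bounded, such that we have the identity (3.13)
`X₁ ⊗ X₂ ⊗ X₃ = ∫_Ω δ(R_{1,ω}ξ₁ + R_{2,ω}ξ₂ + R_{3,ω}ξ₃) F(ω) m_{1,ω}(R_{1,ω}ξ₁) m_{2,ω}(R_{2,ω}ξ₂) m_{3,ω}(R_{3,ω}ξ₃) φ(…) η(…) Λ_{R_{1,ω}ξ₁,R_{2,ω}ξ₂,R_{3,ω}ξ₃}(R_{1,ω}X₁, R_{2,ω}X₂, R_{3,ω}X₃) dμ(ω)`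
for all `ξⱼ ∈ B(ξⱼ⁰, ε₀³)` and `Xⱼ ∈ ξⱼ^⊥` … Indeed, if one applies (3.13) with
`(X₁,X₂,X₃) = (û(ξ₁), v̂(ξ₂), ŵ(ξ₃))`, contracts the resulting tensor against
`\overline{ψ̂₁(ξ₁)} ⊗ \overline{ψ̂₂(ξ₂)} ⊗ \overline{ψ̂₃(ξ₃)}` and then integrates in `ξ₁, ξ₂, ξ₃`
(absorbing the `\overline{ψ̂ᵢ}` and `F` factors into the `m_{j,ω}` terms …), we obtain the desired
decomposition (3.9)". The Dirac delta of (3.13) (footnote 5: an approximation to the identity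
and a limit) is read here, rigorously, as this identity after integration in `ξ₁, ξ₂, ξ₃`
(change of variables `ξⱼ ↦ R_{j,ω}⁻¹ξⱼ` on `{ξ₁+ξ₂+ξ₃=0}`), with `F` and `\overline{ψ̂ⱼ}` absorbed
into the symbols. Printed proof of (3.13): restriction to rotations almost fixing `ξⱼ⁰` (3.14),
so that `φ η ≡ 1` (3.15); the 15-dimensional manifold `Σ`, Haar measure on `SO(3)³` and a
Fourier (plane-wave) expansion of the weight, (3.16) (§3.6); the implicit function theorem and
rotations `R^θ_ξ` about the axes `ξ̃ⱼ`, (3.17)–(3.20) (§3.7); rotation angles `Yⱼ = R^{αⱼ}_{ηⱼ} n`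
and `Θ_{η₁,η₂,η₃}`, (3.21)–(3.23) (§3.8); Fourier inversion on `(ℝ/2πℤ)³` under the
non-degeneracy condition (3.24), verified for the normalisation (3.7) (§3.9). A `Prop`-valued
definition, not asserted. [cite: Tao2016AveragedNS, §3.5 (3.13) and §3.6–3.9 (3.14)–(3.24)] -/
def rotationAverage_tensorIdentity : Prop :=
  ∃ ε₁ : ℝ, 0 < ε₁ ∧ ∀ ε₀ : ℝ, 0 < ε₀ → ε₀ ≤ ε₁ →
    ∀ ψ : Fin 3 → 𝓢(ℝ³, ℂ³), NormalisedProfiles ε₀ ψ →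
      ∃ 𝒟 : ComplexAveragingDatum, (∀ i θ, 𝒟.lam i θ = 1) ∧
        ∀ u v w : L2C, MemH10dfC u → MemH10dfC v → MemH10dfC w →
          ∫ θ, 𝒟.freqSideIntegrand ε₀ θ (fourierFn u) (fourierFn v) (fourierFn w) ∂𝒟.μ =
            (∫ ξ, cdot (fourierFn u ξ) (conj3 (𝓕 (⇑(ψ 0)) ξ))) *
              (∫ ξ, cdot (fourierFn v ξ) (conj3 (𝓕 (⇑(ψ 1)) ξ))) *
                ∫ ξ, cdot (fourierFn w ξ) (conj3 (𝓕 (⇑(ψ 2)) ξ))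

/-! ### (3.9) from (3.13) -/

/-- **Tao 2016, §3.5: the single-scale representation (3.9) follows from the rotation-averaging
identity (3.13)** — `singleScale_isComplexAverageNoDil` from `rotationAverage_tensorIdentity`,
with the same threshold and the same datum: by Plancherel (`pairing_conjL2_schwartz`) the left-hand
side `⟨u, ψ̄₁⟩⟨v, ψ̄₂⟩⟨w, ψ̄₃⟩` of (3.9) is `∏ⱼ ∫ X̂ⱼ · \overline{ψ̂ⱼ}`, and by
`betaRhoZeroForm_slot` its right-hand side `∫_Ω ⟨B_{η,ρ,0}(m₁(D) Rot u, m₂(D) Rot v), m₃(D) Rot w⟩ dμ`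
is the `Ω`-integral of the frequency-side integrand at `(û, v̂, ŵ)`. [cite: Tao2016AveragedNS, §3.5 pp. 17–18] -/
theorem singleScale_isComplexAverageNoDil_of_tensorIdentity (h : rotationAverage_tensorIdentity) :
    singleScale_isComplexAverageNoDil := by
  obtain ⟨ε₁, hε₁, h⟩ := h
  refine ⟨ε₁, hε₁, fun ε₀ hε₀ hle ψ hψ => ?_⟩
  obtain ⟨𝒟, hlam, h𝒟⟩ := h ε₀ hε₀ hle ψ hψ
  refine ⟨𝒟, hlam, fun u v w hu hv hw => ?_⟩
  unfold singleScaleForm ComplexAveragingDatum.average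
  rw [pairing_conjL2_schwartz, pairing_conjL2_schwartz, pairing_conjL2_schwartz,
    ← h𝒟 u v w hu hv hw]
  refine integral_congr_ae (Eventually.of_forall fun θ => ?_)
  exact (𝒟.betaRhoZeroForm_slot hlam ε₀ θ u v w).symm

end Literature.Analysis.FluidPDE.Tao2016
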